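import Summits.NavierStokesRegularity.FunctionalMining.NoGo.LogThresholdBackground
import Summits.NavierStokesRegularity.FunctionalMining.NoGo.LogThresholdPacket
import Summits.NavierStokesRegularity.FunctionalMining.NoGo.PalinstrophySupRateRefutation
import HarnessLib

/-!
# The log-door threshold witness `G_n ± W_K` on `ℝ³`: the three Euclidean budgets

Search for candidate a priori estimates; no regularity claim. NS FUNCTIONAL MINING — NO-GO BRANCH
(cell `pub-nsfunc`, prove seat gen 4). For the N6 witness pair `U_± = G_n ± W_K`
(`NoGo/LogDoorWitness.lean`) this file records, WITHOUT any hypothesis on the candidate budget,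
* `production_add_sub_eq`: `N(U₊) + N(U₋) = −2P₂(G_n) + 2n(∫η³)(a₀g₃ + a₁g₂ − a₂g₁ − a₃g₀)`
  (`N(U) = −∫⟪DU(U), Δ²U⟫`; the `±` trick + locality + `integral_qint`, as in `master_ineq`);
* `laplacianNormSq_add_sub_eq`: `∫‖ΔU₊‖² + ∫‖ΔU₋‖² = 2∫‖ΔG_n‖² + 2∫‖ΔW_K‖²` with the packet
  palinstrophy in closed form (`integral_norm_sq_laplacian_packet`);
* `gradLaplacianNormSq_add_sub_le`: `∫Σᵢ‖∂ᵢΔU_±‖² ≤ 2∫Σᵢ‖∂ᵢΔG_n‖² + 2∫Σᵢ‖∂ᵢΔW_K‖²`.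
Folklore calculus; nothing is asserted about Navier–Stokes.
-/

noncomputable section

open MeasureTheory Set Function Filter Real
open scoped ContDiff Topology Laplacian InnerProductSpace RealInnerProductSpace

namespace Summit.NavierStokesRegularity.FunctionalMining

namespace Sep3

open Literature.Analysis.FunctionSpaces Literature.Analysis.FluidPDE LogDoor

/-- `k ≤ ∞` in `WithTop ℕ∞` for a natural number `k`. [folklore] -/
private theorem natCast_le_inftyW (k : ℕ) : (k : WithTop ℕ∞) ≤ ∞ := by exact_mod_cast le_top

/-- `∞ ≠ 0` in `WithTop ℕ∞`. [folklore] -/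
private theorem infty_ne_zero₁₂ : (∞ : WithTop ℕ∞) ≠ 0 := by simp

/-- `2 ≤ ∞` in `WithTop ℕ∞`. [folklore] -/
private theorem two_le_infty₁₂ : (2 : WithTop ℕ∞) ≤ ∞ := natCast_le_inftyW 2

section Witness

variable (n : ℕ) {r K : ℝ}

/-- **The `±` production identity (no budget hypothesis).** With `G = G_n`, `W = W_K`,
`a = a_r`, `g = g_K`, `η = etaZ`:
`N(G+W) + N(G−W) = −2P₂(G) − 2n(∫η³)(a₃g₀ + a₂g₁ − a₁g₂ − a₀g₃)` (`aₗ = Sq a l`, `gₗ = Sq g l`).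
[folklore] -/
theorem production_add_sub_eq (hr0 : 0 < r) (hr4 : r ≤ 1 / 4) (hcore : (4 : ℝ) ^ n * (8 * r ^ 2) < 2) :
    (-(∫ y, ⟪fderiv ℝ (fun z => background n etaZ z + packet (prof r K) z) y
        (background n etaZ y + packet (prof r K) y),
        Δ (Δ (fun z => background n etaZ z + packet (prof r K) z)) y⟫)) +
    (-(∫ y, ⟪fderiv ℝ (fun z => background n etaZ z - packet (prof r K) z) y
        (background n etaZ y - packet (prof r K) y),
        Δ (Δ (fun z => background n etaZ z - packet (prof r K) z)) y⟫)) =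
      -2 * (∫ y, ⟪fderiv ℝ (background n etaZ) y (background n etaZ y), Δ (Δ (background n etaZ)) y⟫) -
        2 * ((n : ℝ) * J etaZ (0, 0, 0) *
          (Sq (bumpR r) 3 * Sq (gK (bumpR r) K) 0 + Sq (bumpR r) 2 * Sq (gK (bumpR r) K) 1 -
            Sq (bumpR r) 1 * Sq (gK (bumpR r) K) 2 - Sq (bumpR r) 0 * Sq (gK (bumpR r) K) 3)) := by
  have hr1 : r ≤ 1 := by linarith
  set G : E3 → E3 := background n etaZ with hGdef
  set φ : Fin 3 → ℝ → ℝ := prof r K with hφdef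
  have hφ : ∀ i, ContDiff ℝ ∞ (φ i) := prof_contDiff r K
  have hφ0 : ∀ i t, 2 < |t| → φ i t = 0 := prof_eq_zero hr0 hr1 K
  set W : E3 → E3 := packet φ with hWdef
  have hGs : ContDiff ℝ ∞ G := contDiff_background etaZ_contDiff
  have hWs : ContDiff ℝ ∞ W := contDiff_packet hφ
  have hts : ∀ t s : ℝ, tsupport (fun y => t • G y + s • W y) ⊆ Metric.closedBall 0 2 :=
    fun t s => tsupport_subset hr0 hr4 K n t s
  have hG_ts : tsupport G ⊆ Metric.closedBall 0 2 := by simpa using hts 1 0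
  have hW_ts : tsupport W ⊆ Metric.closedBall 0 2 := by simpa using hts 0 1
  have hGc : HasCompactSupport G :=
    HasCompactSupport.of_support_subset_isCompact (isCompact_closedBall 0 2) (subset_closure.trans hG_ts)
  have hWc : HasCompactSupport W :=
    HasCompactSupport.of_support_subset_isCompact (isCompact_closedBall 0 2) (subset_closure.trans hW_ts)
  have hexp := production2_add_add_sub hGs hWs hGc hWc
  -- locality
  have hU : IsOpen {y : E3 | (4 : ℝ) ^ n * Qr y < 2} :=
    isOpen_lt (continuous_const.mul contDiff_Qr.continuous) continuous_const
  have hGE : ∀ y ∈ {y : E3 | (4 : ℝ) ^ n * Qr y < 2}, G y = strain (n : ℝ) etaZ y :=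
    fun y hy => background_eq_strain_of_core hy
  have hWU : ∀ y, y ∉ {y : E3 | (4 : ℝ) ^ n * Qr y < 2} → W =ᶠ[𝓝 y] fun _ => 0 := by
    intro y hy
    apply packet_eventuallyEq_zero hr0 K
    by_contra hc
    rw [not_or, not_or, not_lt, not_lt] at hc
    have h0 : y 0 ^ 2 ≤ (2 * r) ^ 2 := by rw [← sq_abs]; nlinarith [abs_nonneg (y 0), hc.1]
    have h1 : y 1 ^ 2 ≤ (2 * r) ^ 2 := by rw [← sq_abs]; nlinarith [abs_nonneg (y 1), hc.2.1]
    apply hy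
    show (4 : ℝ) ^ n * Qr y < 2
    have hQ : Qr y ≤ 8 * r ^ 2 := by unfold Qr; nlinarith
    calc (4 : ℝ) ^ n * Qr y ≤ 4 ^ n * (8 * r ^ 2) := mul_le_mul_of_nonneg_left hQ (by positivity)
      _ < 2 := hcore
  have hloc : (∫ y, (⟪fderiv ℝ W y (W y), Δ (Δ G) y⟫ + ⟪fderiv ℝ G y (W y), Δ (Δ W) y⟫ +
      ⟪fderiv ℝ W y (G y), Δ (Δ W) y⟫)) = ∫ y, qint φ n y :=
    integral_congr_ae (ae_of_all _ fun y => secondVariation_congr_of_local hU hGE hWU y)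
  have hQ := integral_qint hφ hφ0 (n : ℝ)
  simp only [hφdef, prof_zero, prof_one, prof_two] at hQ
  rw [← hQ, ← hloc]
  linarith [hexp]

/-- **The `±` palinstrophy identity** with the packet palinstrophy in closed form. [folklore] -/
theorem laplacianNormSq_add_sub_eq (hr0 : 0 < r) (hr4 : r ≤ 1 / 4) :
    (∫ y, ‖Δ (fun z => background n etaZ z + packet (prof r K) z) y‖ ^ 2) +
      (∫ y, ‖Δ (fun z => background n etaZ z - packet (prof r K) z) y‖ ^ 2) =
      2 * (∫ y, ‖Δ (background n etaZ) y‖ ^ 2) +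
        2 * (Sq etaZ 0 * (Sq (bumpR r) 0 * Sq (gK (bumpR r) K) 3 + 3 * (Sq (bumpR r) 1 * Sq (gK (bumpR r) K) 2) +
            3 * (Sq (bumpR r) 2 * Sq (gK (bumpR r) K) 1) + Sq (bumpR r) 3 * Sq (gK (bumpR r) K) 0) +
          2 * Sq etaZ 1 * (Sq (bumpR r) 0 * Sq (gK (bumpR r) K) 2 + 2 * (Sq (bumpR r) 1 * Sq (gK (bumpR r) K) 1) +
            Sq (bumpR r) 2 * Sq (gK (bumpR r) K) 0) +
          Sq etaZ 2 * (Sq (bumpR r) 0 * Sq (gK (bumpR r) K) 1 + Sq (bumpR r) 1 * Sq (gK (bumpR r) K) 0)) := by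
  have hr1 : r ≤ 1 := by linarith
  have hφ : ∀ i, ContDiff ℝ ∞ (prof r K i) := prof_contDiff r K
  have hφ0 : ∀ i t, 2 < |t| → prof r K i t = 0 := prof_eq_zero hr0 hr1 K
  have hGs : ContDiff ℝ ∞ (background n etaZ) := contDiff_background etaZ_contDiff
  have hWs : ContDiff ℝ ∞ (packet (prof r K)) := contDiff_packet hφ
  have hts : ∀ t s : ℝ, tsupport (fun y => t • background n etaZ y + s • packet (prof r K) y) ⊆
      Metric.closedBall 0 2 := fun t s => tsupport_subset hr0 hr4 K n t s
  have hG_ts : tsupport (background n etaZ) ⊆ Metric.closedBall 0 2 := by simpa using hts 1 0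
  have hW_ts : tsupport (packet (prof r K)) ⊆ Metric.closedBall 0 2 := by simpa using hts 0 1
  have hGc : HasCompactSupport (background n etaZ) :=
    HasCompactSupport.of_support_subset_isCompact (isCompact_closedBall 0 2) (subset_closure.trans hG_ts)
  have hWc : HasCompactSupport (packet (prof r K)) :=
    HasCompactSupport.of_support_subset_isCompact (isCompact_closedBall 0 2) (subset_closure.trans hW_ts)
  have hpar := laplacianNormSq_add_add_sub hGs hWs hGc hWc
  have hPW := integral_norm_sq_laplacian_packet hφ hφ0
  simp only [prof_zero, prof_one, prof_two] at hPW
  rw [hpar, hPW]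

/-- The integrand `Σᵢ ‖∂ᵢΔF‖²` of a smooth compactly supported field is integrable. [folklore] -/
theorem integrable_gradLaplacianNormSq {F : E3 → E3} (hF : ContDiff ℝ ∞ F) (hFc : HasCompactSupport F) :
    Integrable fun y => ∑ i : Fin 3, ‖fderiv ℝ (Δ F) y (EuclideanSpace.single i 1)‖ ^ 2 := by
  have hΔ : ContDiff ℝ ∞ (Δ F) := contDiff_laplacian hF
  have hc : Continuous fun y => ∑ i : Fin 3, ‖fderiv ℝ (Δ F) y (EuclideanSpace.single i 1)‖ ^ 2 :=
    continuous_finsetSum _ fun i _ =>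
      (((hΔ.continuous_fderiv infty_ne_zero₁₂).clm_apply continuous_const).norm).pow 2
  refine hc.integrable_of_hasCompactSupport (HasCompactSupport.intro hFc fun y hy => ?_)
  have h1 : y ∉ tsupport (Δ F) := fun h => hy (tsupport_laplacian_subset' _ h)
  simp [fderiv_of_notMem_tsupport ℝ h1]

/-- **`∫Σᵢ‖∂ᵢΔ(G ± W)‖² ≤ 2∫Σᵢ‖∂ᵢΔG‖² + 2∫Σᵢ‖∂ᵢΔW‖²`** for smooth compactly supported fields.
[folklore] -/
theorem gradLaplacianNormSq_add_sub_le {G W : E3 → E3} (hG : ContDiff ℝ ∞ G) (hW : ContDiff ℝ ∞ W)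
    (hGc : HasCompactSupport G) (hWc : HasCompactSupport W) :
    (∫ y, ∑ i : Fin 3, ‖fderiv ℝ (Δ (fun z => G z + W z)) y (EuclideanSpace.single i 1)‖ ^ 2) ≤
        2 * (∫ y, ∑ i : Fin 3, ‖fderiv ℝ (Δ G) y (EuclideanSpace.single i 1)‖ ^ 2) +
          2 * (∫ y, ∑ i : Fin 3, ‖fderiv ℝ (Δ W) y (EuclideanSpace.single i 1)‖ ^ 2) ∧
      (∫ y, ∑ i : Fin 3, ‖fderiv ℝ (Δ (fun z => G z - W z)) y (EuclideanSpace.single i 1)‖ ^ 2) ≤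
        2 * (∫ y, ∑ i : Fin 3, ‖fderiv ℝ (Δ G) y (EuclideanSpace.single i 1)‖ ^ 2) +
          2 * (∫ y, ∑ i : Fin 3, ‖fderiv ℝ (Δ W) y (EuclideanSpace.single i 1)‖ ^ 2) := by
  have hΔG : ContDiff ℝ ∞ (Δ G) := contDiff_laplacian hG
  have hΔW : ContDiff ℝ ∞ (Δ W) := contDiff_laplacian hW
  have hΔGd : Differentiable ℝ (Δ G) := hΔG.differentiable infty_ne_zero₁₂
  have hΔWd : Differentiable ℝ (Δ W) := hΔW.differentiable infty_ne_zero₁₂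
  have hΔa : Δ (fun z => G z + W z) = fun z => Δ G z + Δ W z := by
    funext z
    exact ContDiffAt.laplacian_add (hG.of_le two_le_infty₁₂).contDiffAt (hW.of_le two_le_infty₁₂).contDiffAt
  have hΔs : Δ (fun z => G z - W z) = fun z => Δ G z - Δ W z := by
    funext z
    exact ContDiffAt.laplacian_sub (hG.of_le two_le_infty₁₂).contDiffAt (hW.of_le two_le_infty₁₂).contDiffAt
  have iG := integrable_gradLaplacianNormSq hG hGc
  have iW := integrable_gradLaplacianNormSq hW hWc
  have hbound : Integrable fun y => 2 * (∑ i : Fin 3, ‖fderiv ℝ (Δ G) y (EuclideanSpace.single i 1)‖ ^ 2) +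
      2 * (∑ i : Fin 3, ‖fderiv ℝ (Δ W) y (EuclideanSpace.single i 1)‖ ^ 2) :=
    (iG.const_mul 2).add (iW.const_mul 2)
  have hval : (∫ y, 2 * (∑ i : Fin 3, ‖fderiv ℝ (Δ G) y (EuclideanSpace.single i 1)‖ ^ 2) +
      2 * (∑ i : Fin 3, ‖fderiv ℝ (Δ W) y (EuclideanSpace.single i 1)‖ ^ 2)) =
      2 * (∫ y, ∑ i : Fin 3, ‖fderiv ℝ (Δ G) y (EuclideanSpace.single i 1)‖ ^ 2) +
        2 * (∫ y, ∑ i : Fin 3, ‖fderiv ℝ (Δ W) y (EuclideanSpace.single i 1)‖ ^ 2) := by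
    rw [integral_add (iG.const_mul 2) (iW.const_mul 2), integral_const_mul, integral_const_mul]
  have hpt : ∀ (s : ℝ) (y : E3), s = 1 ∨ s = -1 →
      ∑ i : Fin 3, ‖fderiv ℝ (Δ G) y (EuclideanSpace.single i 1) + s • fderiv ℝ (Δ W) y (EuclideanSpace.single i 1)‖ ^ 2 ≤
        2 * (∑ i : Fin 3, ‖fderiv ℝ (Δ G) y (EuclideanSpace.single i 1)‖ ^ 2) +
          2 * (∑ i : Fin 3, ‖fderiv ℝ (Δ W) y (EuclideanSpace.single i 1)‖ ^ 2) := by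
    intro s y hs
    rw [Finset.mul_sum, Finset.mul_sum, ← Finset.sum_add_distrib]
    refine Finset.sum_le_sum fun i _ => ?_
    set a := fderiv ℝ (Δ G) y (EuclideanSpace.single i 1)
    set b := fderiv ℝ (Δ W) y (EuclideanSpace.single i 1)
    have hpl := norm_add_sq_real a b
    have hmi := norm_sub_sq_real a b
    rcases hs with rfl | rfl
    · rw [one_smul]; nlinarith [norm_nonneg (a - b)]
    · rw [neg_one_smul, ← sub_eq_add_neg]; nlinarith [norm_nonneg (a + b)]
  constructor
  · rw [hΔa, ← hval]
    refine integral_mono_of_nonneg (ae_of_all _ fun y => Finset.sum_nonneg fun _ _ => sq_nonneg _) hbound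
      (ae_of_all _ fun y => ?_)
    have h := hpt 1 y (Or.inl rfl)
    have e : ∀ i : Fin 3, fderiv ℝ (fun z => Δ G z + Δ W z) y (EuclideanSpace.single i 1) =
        fderiv ℝ (Δ G) y (EuclideanSpace.single i 1) + (1 : ℝ) • fderiv ℝ (Δ W) y (EuclideanSpace.single i 1) :=
      fun i => by rw [fderiv_fun_add (hΔGd y) (hΔWd y), one_smul]; rfl
    simpa only [e] using h
  · rw [hΔs, ← hval]
    refine integral_mono_of_nonneg (ae_of_all _ fun y => Finset.sum_nonneg fun _ _ => sq_nonneg _) hbound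
      (ae_of_all _ fun y => ?_)
    have h := hpt (-1) y (Or.inr rfl)
    have e : ∀ i : Fin 3, fderiv ℝ (fun z => Δ G z - Δ W z) y (EuclideanSpace.single i 1) =
        fderiv ℝ (Δ G) y (EuclideanSpace.single i 1) + (-1 : ℝ) • fderiv ℝ (Δ W) y (EuclideanSpace.single i 1) :=
      fun i => by rw [fderiv_fun_sub (hΔGd y) (hΔWd y), neg_one_smul, ← sub_eq_add_neg]; rfl
    simpa only [e] using h

end Witness

end Sep3

end Summit.NavierStokesRegularity.FunctionalMining

end
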